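import Summits.BirchSwinnertonDyer.BirchSwinnertonDyer.Theorems.ResidualThetaTransportAtTwoThetaTransportLocalClauseStability
import HarnessLib

/-!
# The `g`-side counted set of S2 is the `ϖ`-torsion of an `𝒪`-stable subgroup of `H¹(Γ_{ℚ_∞}, A_g)`
# (crux (R≥)ᵖ `ResidualThetaCountLowerPureAtTwo`, line «bt26-lambda», stub S2 `stub_cmLambdaLower`)

Route `ResidualThetaTransportAtTwo` (RTT), crux (R≥)ᵖ `ResidualThetaCountLowerPureAtTwo` (stmt-BirchSwinnertonDyer-26074),
line «bt26-lambda»; seat `prover-bsd-rtt-w3` g0 (width helper, `--supports`, closes nothing). HONEST FRAMING: THEOREMS ONLY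
(no definition, no named fact, no instance, no `sorry`); CONDITIONAL on the route's print binder
`SerreSupersingularDecompositionImageInput` (Serre 1972 Prop. 12, item stmt-BirchSwinnertonDyer-27793), hypothesis `hSe`, exactly
like `…IntegralSchurAtTwo`; BSD is not proved by any of this.

WHAT. S2 (`stub_cmLambdaLower`) bounds from below the `ncard` of the SET-BUILDER
`Sel_Θ[ϖ] = {y ∈ H¹(Γ_{ℚ_∞}, A_g) | unramified outside 2S₀ ∧ archimedean ∧ (∀ v ∣ 2, ∀ σ, transported ⊕E⁺-Kummer clause for Θ_v)
∧ ϖ·y = 0}`. Every λ-argument (Pontryagin dual `X_g` as a `Λ_𝒪`-module, `#Sel[ϖ] = #X_g/ϖX_g ≥ q^{rank}`) needs this set to be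
`S[ϖ]` for an `𝒪`-SUBMODULE `S`. This file proves exactly that, in S2's literal vocabulary and without any definition:
* `resH1Hom_inertiaInToH_comp_scalarH1`, `scalarH1_mem_unramifiedKer`, **`scalarH1_mem_unramifiedOutside`** — scalars of `M`
  commuting with `Γ_K` preserve GV's unramified conditions (naturality of restriction to inertia, `resH1Hom_comp`); generic `K`;
* **`exists_addSubgroup_scalar_stable_selTransported`** — for the θ-datum `(n, ρ, Θ)` of the line: there is an `AddSubgroup S` of
  `H¹(κ.kerSubgroup, Cofree ρ E)`, stable under `scalarH1 r` for every `r ∈ 𝒪 = padicCoeffIntegers (range ι)` and under every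
  conjugation `conjH1 τ`, `τ ∈ Γ_ℚ` (so it carries the `Λ_𝒪`-structure `T = conj_γ − 1`), whose members are
  exactly the classes satisfying the three Selmer clauses of S2, and for every `ϖ` the counted set of S2 equals `{y ∈ S | scalarH1 ϖ y = 0}`.
  Ingredients: `exists_addSubgroup_transportedKummer`, `transportedKummer_conj_scalarH1` (integral Schur, `…LocalClauseStability`),
  the tree's `scalarH1_mem_infKer`, `conjH1_comp_scalarH1`, and `ZpExtension.isClosed_kerSubgroup`.

References: [SerreInventiones1972] §1.11 Prop. 12, §2.2; [Kobayashi2003] Def. 1.1; [EmertonPollackWeston2006] §3.1; [GreenbergVatsal2000] §2.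
-/

set_option autoImplicit false
-- the Theorems namespace of this sub repeats the summit name by design (D-0017 nested layout)
set_option linter.dupNamespace false

noncomputable section

open scoped AddSubgroup
open WeierstrassCurve NumberField Field IsDedekindDomain Literature Literature.NumberTheory.EllipticCurves
  Literature.NumberTheory.EllipticCurves.GreenbergSelmer Literature.NumberTheory.EllipticCurves.GreenbergVatsal2000
  Literature.NumberTheory.GaloisRepresentations Literature.NumberTheory.EllipticCurves.Rank1Residual

universe u

namespace Summit.BirchSwinnertonDyer.BirchSwinnertonDyer.Theorems.ThetaTransport

/-! ### §1. Scalars preserve the unramified conditions -/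

section Unramified

variable {K : Type u} [Field K] [NumberField K] (H : Subgroup (absoluteGaloisGroup K))
  (M : Type u) [AddCommGroup M] [DistribMulAction (absoluteGaloisGroup K) M] [TopologicalSpace M] [DiscreteTopology M]
  {R : Type*} [Monoid R] [DistribMulAction R M] [SMulCommClass (absoluteGaloisGroup K) R M]

/-- Restriction to the inertia subgroup `H ⊓ I_v` commutes with scalars (functoriality of `H¹` in compatible pairs,
`resH1Hom_comp`). [cite: NeukirchSchmidtWingberg2008, I.§5] -/
theorem resH1Hom_inertiaInToH_comp_scalarH1 (v : HeightOneSpectrum (𝓞 K)) (r : R) :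
    (resH1Hom (inertiaInToH H v) (AddMonoidHom.id M) fun _ _ ↦ rfl).comp (scalarH1 H M r) =
      (scalarH1 (inertiaIn H v) M r).comp (resH1Hom (inertiaInToH H v) (AddMonoidHom.id M) fun _ _ ↦ rfl) := by
  rw [scalarH1, scalarH1, resH1Hom_comp, resH1Hom_comp]
  exact resH1Hom_congr (by ext; rfl) (by ext; rfl) _ _

/-- Scalars preserve GV's unramified condition at `v` (`unramifiedKer`). [cite: GreenbergVatsal2000, §2 pp. 16, 23] -/
theorem scalarH1_mem_unramifiedKer (v : HeightOneSpectrum (𝓞 K)) (r : R) {c : subgroupH1 H M}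
    (hc : c ∈ unramifiedKer H M v) : scalarH1 H M r c ∈ unramifiedKer H M v := by
  rw [GreenbergVatsal2000.unramifiedKer, AddMonoidHom.mem_ker] at hc ⊢
  rw [← AddMonoidHom.comp_apply, resH1Hom_inertiaInToH_comp_scalarH1, AddMonoidHom.comp_apply, hc, map_zero]

/-- **Scalars preserve GV's `unramifiedOutside`** (all conjugates: `conj_σ ∘ scalarH1 r = scalarH1 r ∘ conj_σ`).
[cite: GreenbergVatsal2000, §2 pp. 16, 23] [cite: EmertonPollackWeston2006, §3.1] -/
theorem scalarH1_mem_unramifiedOutside [H.Normal] (p : ℕ) (S₀ : Set (HeightOneSpectrum (𝓞 K))) (r : R)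
    {c : subgroupH1 H M} (hc : c ∈ unramifiedOutside H M p S₀) : scalarH1 H M r c ∈ unramifiedOutside H M p S₀ := by
  rw [mem_unramifiedOutside_iff] at hc ⊢
  intro v hv hp σ
  rw [← AddMonoidHom.comp_apply, conjH1_comp_scalarH1, AddMonoidHom.comp_apply]
  exact scalarH1_mem_unramifiedKer H M v r (hc v hv hp σ)

end Unramified

/-! ### §2. The counted set of S2 is `S[ϖ]` for an `𝒪`-stable subgroup `S` -/

/-- Membership in `U ⊓ (⨅ w σ, (I w).comap (c σ)) ⊓ (⨅ v hv, T v hv)` (bookkeeping for the three Selmer clauses). [folklore] -/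
theorem mem_inf_iInf_comap_inf_iInf_iff {X : Type*} [AddCommGroup X] {Ω Γ V : Type*} {P : V → Prop}
    (U : AddSubgroup X) (I : Ω → AddSubgroup X) (c : Γ → X →+ X) (T : ∀ v : V, P v → AddSubgroup X) (y : X) :
    y ∈ U ⊓ (⨅ (w : Ω) (σ : Γ), (I w).comap (c σ)) ⊓ (⨅ (v : V) (hv : P v), T v hv) ↔
      y ∈ U ∧ (∀ (w : Ω) (σ : Γ), c σ y ∈ I w) ∧ ∀ (v : V) (hv : P v), y ∈ T v hv := by
  simp only [AddSubgroup.mem_inf, AddSubgroup.mem_iInf, AddSubgroup.mem_comap, and_assoc]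


variable (W : WeierstrassCurve ℚ) [W.IsElliptic] [W.IsGloballyMinimal] {M : ℕ}
  {g : CuspForm (CongruenceSubgroup.Gamma0 M) 2} {ι : ModularForms.coeffField g →+* PadicAlgCl 2}

set_option maxHeartbeats 400000 in
/-- **The `g`-side counted set of S2 is the `ϖ`-torsion of an `𝒪`-stable subgroup** (granted Serre 1972 Prop. 12). On the habitat
(`GoodSS W 2`, `a₂ = 0`), for the θ-datum `(n, ρ, Θ)` of line «bt26-lambda» (`Θ_v : A_g ≃+ (W[2^∞])ⁿ` equivariant for the
decomposition group at `v ∣ 2`, `A_g = Cofree ρ E`, `E = padicCoeffField (range ι)`), any `κ`, `S₀`: there is an additive subgroup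
`S ≤ H¹(κ.kerSubgroup, A_g)` with (i) `scalarH1 r S ⊆ S` for every `r ∈ 𝒪 = padicCoeffIntegers (range ι)`; (i') `conjH1 τ S ⊆ S` for
every `τ ∈ Γ_ℚ` (`conj_σ ∘ conj_τ = conj_{στ}`, all clauses carry every conjugate); (ii) `y ∈ S` iff `y` satisfies the unramified,
archimedean and transported-plus-Kummer clauses of S2 verbatim; (iii) for every `ϖ`, S2's counted set `= {y | y ∈ S ∧ scalarH1 ϖ y = 0}`. [cite: SerreInventiones1972, §1.11 Prop. 12; §2.2] [cite: EmertonPollackWeston2006, §3.1]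
[cite: Kobayashi2003, Def. 1.1] [cite: GreenbergVatsal2000, §2 pp. 16, 23] -/
theorem exists_addSubgroup_scalar_stable_selTransported (hSe : serre1972_supersingular_decompositionSubgroup_image)
    (hss : GoodSS W 2) (ha2 : W.frobeniusTrace 2 = 0) (κ : ZpExtension ℚ 2) (S₀ : Finset (HeightOneSpectrum (𝓞 ℚ)))
    (n : ℕ) (ρ : FramedGaloisRep ℚ ↥(padicCoeffIntegers (Set.range ι)) 2)
    (Θ : ∀ v : HeightOneSpectrum (𝓞 ℚ), ((2 : ℕ) : 𝓞 ℚ) ∈ v.asIdeal →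
      ((Cofree ρ ↥(padicCoeffField (Set.range ι))) ≃+ (Fin n → ↥(W.geomPrimaryTorsion 2))))
    (hΘ : ∀ (v : HeightOneSpectrum (𝓞 ℚ)) (hv : ((2 : ℕ) : 𝓞 ℚ) ∈ v.asIdeal) (δ : absoluteGaloisGroup (v.adicCompletion ℚ))
      (m : Cofree ρ ↥(padicCoeffField (Set.range ι))) (i : Fin n),
      Θ v hv ((resGalOfEmb (closureEmb (K := ℚ) (v.adicCompletion ℚ)) δ) • m) i =
        (resGalOfEmb (closureEmb (K := ℚ) (v.adicCompletion ℚ)) δ) • (Θ v hv m i)) :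
    ∃ S : AddSubgroup (subgroupH1 κ.kerSubgroup (Cofree ρ ↥(padicCoeffField (Set.range ι)))),
      (∀ (r : ↥(padicCoeffIntegers (Set.range ι))) (y : subgroupH1 κ.kerSubgroup (Cofree ρ ↥(padicCoeffField (Set.range ι)))),
        y ∈ S → scalarH1 κ.kerSubgroup (Cofree ρ ↥(padicCoeffField (Set.range ι))) r y ∈ S) ∧
      (∀ (τ : absoluteGaloisGroup ℚ) (y : subgroupH1 κ.kerSubgroup (Cofree ρ ↥(padicCoeffField (Set.range ι)))),
        y ∈ S → conjH1 κ.kerSubgroup (Cofree ρ ↥(padicCoeffField (Set.range ι))) τ y ∈ S) ∧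
      (∀ y : subgroupH1 κ.kerSubgroup (Cofree ρ ↥(padicCoeffField (Set.range ι))), y ∈ S ↔
        (y ∈ unramifiedOutside κ.kerSubgroup (Cofree ρ ↥(padicCoeffField (Set.range ι))) 2
            (↑S₀ : Set (HeightOneSpectrum (𝓞 ℚ))) ∧
        (∀ (w : InfinitePlace ℚ) (σ : absoluteGaloisGroup ℚ),
          conjH1 κ.kerSubgroup (Cofree ρ ↥(padicCoeffField (Set.range ι))) σ y ∈
            infKer κ.kerSubgroup (Cofree ρ ↥(padicCoeffField (Set.range ι))) w) ∧
        (∀ (v : HeightOneSpectrum (𝓞 ℚ)) (hv : ((2 : ℕ) : 𝓞 ℚ) ∈ v.asIdeal) (σ : absoluteGaloisGroup ℚ),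
          ∃ (φ : contOneCocycles (discreteTopRep κ.kerSubgroup (Cofree ρ ↥(padicCoeffField (Set.range ι)))))
            (Q : Fin n → localPoints W (v.adicCompletion ℚ)) (k : ℕ),
            oneCocycleClass (discreteTopRep κ.kerSubgroup (Cofree ρ ↥(padicCoeffField (Set.range ι)))) φ =
              conjH1 κ.kerSubgroup (Cofree ρ ↥(padicCoeffField (Set.range ι))) σ y ∧
            (∀ i : Fin n, (2 ^ k) • Q i ∈ ⨆ m : ℕ, Kobayashi2003.signedLocalPoints κ (v.adicCompletion ℚ) W 1 m) ∧
            ∀ (τ : localSubgroupOfEmb κ.kerSubgroup (closureEmb (K := ℚ) (v.adicCompletion ℚ))) (i : Fin n),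
              pointsMapOfEmb W (closureEmb (K := ℚ) (v.adicCompletion ℚ))
                (((Θ v hv (φ.1 (resGalSubgroupOfEmb κ.kerSubgroup (closureEmb (K := ℚ) (v.adicCompletion ℚ)) τ))) i :
                  ↥(W.geomPrimaryTorsion 2)) : W.geomPoints) = (τ : absoluteGaloisGroup (v.adicCompletion ℚ)) • Q i - Q i))) ∧
      ∀ ϖ : ↥(padicCoeffIntegers (Set.range ι)),
        {y : subgroupH1 κ.kerSubgroup (Cofree ρ ↥(padicCoeffField (Set.range ι))) |
          y ∈ unramifiedOutside κ.kerSubgroup (Cofree ρ ↥(padicCoeffField (Set.range ι))) 2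
              (↑S₀ : Set (HeightOneSpectrum (𝓞 ℚ))) ∧
          (∀ (w : InfinitePlace ℚ) (σ : absoluteGaloisGroup ℚ),
            conjH1 κ.kerSubgroup (Cofree ρ ↥(padicCoeffField (Set.range ι))) σ y ∈
              infKer κ.kerSubgroup (Cofree ρ ↥(padicCoeffField (Set.range ι))) w) ∧
          (∀ (v : HeightOneSpectrum (𝓞 ℚ)) (hv : ((2 : ℕ) : 𝓞 ℚ) ∈ v.asIdeal) (σ : absoluteGaloisGroup ℚ),
            ∃ (φ : contOneCocycles (discreteTopRep κ.kerSubgroup (Cofree ρ ↥(padicCoeffField (Set.range ι)))))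
              (Q : Fin n → localPoints W (v.adicCompletion ℚ)) (k : ℕ),
              oneCocycleClass (discreteTopRep κ.kerSubgroup (Cofree ρ ↥(padicCoeffField (Set.range ι)))) φ =
                conjH1 κ.kerSubgroup (Cofree ρ ↥(padicCoeffField (Set.range ι))) σ y ∧
              (∀ i : Fin n, (2 ^ k) • Q i ∈ ⨆ m : ℕ, Kobayashi2003.signedLocalPoints κ (v.adicCompletion ℚ) W 1 m) ∧
              ∀ (τ : localSubgroupOfEmb κ.kerSubgroup (closureEmb (K := ℚ) (v.adicCompletion ℚ))) (i : Fin n),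
                pointsMapOfEmb W (closureEmb (K := ℚ) (v.adicCompletion ℚ))
                  (((Θ v hv (φ.1 (resGalSubgroupOfEmb κ.kerSubgroup (closureEmb (K := ℚ) (v.adicCompletion ℚ)) τ))) i :
                    ↥(W.geomPrimaryTorsion 2)) : W.geomPoints) = (τ : absoluteGaloisGroup (v.adicCompletion ℚ)) • Q i - Q i) ∧
          scalarH1 κ.kerSubgroup (Cofree ρ ↥(padicCoeffField (Set.range ι))) ϖ y = 0} =
        {y | y ∈ S ∧ scalarH1 κ.kerSubgroup (Cofree ρ ↥(padicCoeffField (Set.range ι))) ϖ y = 0} := by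
  -- the local subgroups at `v ∣ 2`
  have hloc := fun (v : HeightOneSpectrum (𝓞 ℚ)) (hv : ((2 : ℕ) : 𝓞 ℚ) ∈ v.asIdeal) ↦
    exists_addSubgroup_transportedKummer W (A := Cofree ρ ↥(padicCoeffField (Set.range ι))) κ.kerSubgroup v (Θ v hv)
      (⨆ m : ℕ, Kobayashi2003.signedLocalPoints κ (v.adicCompletion ℚ) W 1 m)
  choose Sv hSv using hloc
  -- the subgroup (kept abstract: `Exists.elim`, no pattern matching against the large goal)
  have hex : ∃ S : AddSubgroup (subgroupH1 κ.kerSubgroup (Cofree ρ ↥(padicCoeffField (Set.range ι)))), ∀ y, y ∈ S ↔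
      (y ∈ unramifiedOutside κ.kerSubgroup (Cofree ρ ↥(padicCoeffField (Set.range ι))) 2
          (↑S₀ : Set (HeightOneSpectrum (𝓞 ℚ))) ∧
      (∀ (w : InfinitePlace ℚ) (σ : absoluteGaloisGroup ℚ),
        conjH1 κ.kerSubgroup (Cofree ρ ↥(padicCoeffField (Set.range ι))) σ y ∈
          infKer κ.kerSubgroup (Cofree ρ ↥(padicCoeffField (Set.range ι))) w) ∧
      (∀ (v : HeightOneSpectrum (𝓞 ℚ)) (hv : ((2 : ℕ) : 𝓞 ℚ) ∈ v.asIdeal), y ∈ Sv v hv)) :=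
    ⟨_, mem_inf_iInf_comap_inf_iInf_iff
      (unramifiedOutside κ.kerSubgroup (Cofree ρ ↥(padicCoeffField (Set.range ι))) 2 (↑S₀ : Set (HeightOneSpectrum (𝓞 ℚ))))
      (infKer κ.kerSubgroup (Cofree ρ ↥(padicCoeffField (Set.range ι))))
      (conjH1 κ.kerSubgroup (Cofree ρ ↥(padicCoeffField (Set.range ι)))) Sv⟩
  refine hex.elim fun S hS ↦ ?_
  have hS' := fun y ↦ (hS y).trans
    (and_congr_right fun _ ↦ and_congr_right fun _ ↦ forall_congr' fun v ↦ forall_congr' fun hv ↦ hSv v hv y)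
  refine ⟨S, fun r y hy ↦ ?_, fun τ y hy ↦ ?_, hS', fun ϖ ↦ Set.ext fun y ↦ ?_⟩
  · -- `𝒪`-stability, clause by clause
    have h := (hS' y).1 hy
    refine (hS' _).2 ⟨scalarH1_mem_unramifiedOutside κ.kerSubgroup _ 2 _ r h.1, fun w σ ↦ ?_, fun v hv σ ↦ ?_⟩
    · rw [← AddMonoidHom.comp_apply, conjH1_comp_scalarH1, AddMonoidHom.comp_apply]
      exact scalarH1_mem_infKer κ.kerSubgroup _ w r (h.2.1 w σ)
    · exact transportedKummer_conj_scalarH1 W hSe hss ha2 v hv κ.kerSubgroup κ.isClosed_kerSubgroup (Θ v hv) (hΘ v hv)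
        _ r y (h.2.2 v hv) σ
  · -- `Γ_ℚ`-stability (all clauses are stated with every conjugate): `conj_σ ∘ conj_τ = conj_{στ}`
    have h := (hS' y).1 hy
    have e : ∀ σ : absoluteGaloisGroup ℚ,
        conjH1 κ.kerSubgroup (Cofree ρ ↥(padicCoeffField (Set.range ι))) σ
          (conjH1 κ.kerSubgroup (Cofree ρ ↥(padicCoeffField (Set.range ι))) τ y) =
        conjH1 κ.kerSubgroup (Cofree ρ ↥(padicCoeffField (Set.range ι))) (σ * τ) y := fun σ ↦ by
      rw [Literature.NumberTheory.EllipticCurves.conjH1_mul_holds, AddMonoidHom.comp_apply]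
    refine (hS' _).2 ⟨?_, fun w σ ↦ ?_, fun v hv σ ↦ ?_⟩
    · rw [mem_unramifiedOutside_iff]
      intro v hv hp σ
      rw [e σ]
      exact (mem_unramifiedOutside_iff _).1 h.1 v hv hp (σ * τ)
    · rw [e σ]; exact h.2.1 w (σ * τ)
    · exact (h.2.2 v hv (σ * τ)).elim fun φ hφ ↦ hφ.elim fun Q hQ ↦ hQ.elim fun k hk ↦
        ⟨φ, Q, k, hk.1.trans (e σ).symm, hk.2⟩
  · simp only [Set.mem_setOf_eq, hS', and_assoc]

end Summit.BirchSwinnertonDyer.BirchSwinnertonDyer.Theorems.ThetaTransport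

end
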